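import Summits.Ventures.PercRepro.C041TriDomContract
import Summits.Ventures.PercRepro.C041TriDomAnchoredReductions

/-!
# ROW C-041 — THEOREM (CONTRACTION OF A DOUBLE EDGE) FOR THE ANCHORED ORIENTATION
(p6, gen 47; P6-TWOEXIT-LEAN.md §53 ADDENDUM 19)

The anchored crossed classes `(s₁,s₂) ∪ (s₂,s₃) ∪ (s₁,s₃)` (`AncCrossedS`, `C041TriDomAnchoredReductions`) are, like
the cyclic ones, Boolean combinations of the six connectivities, so THE REACH TRANSPORT of `C041TriDomContract`
carries them to the contracted host (`ancCrossedS_contract_iff`), and the anchored up-set conjecture on a status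
with a double edge `f = p–q` is the anchored conjecture on `contractHost Z₁ p q` with `f` absent and the marks
renamed (`ancDominationS_contract_iff`).  With `ancDominationS_of_twoExit / _of_redundant / _of_parallel /
_of_twoCut` this gives the anchored orientation every reduction of the cyclic one except the cut-vertex gluing,
whose anchored form is still open.
-/

namespace PercRepro

namespace ZoneZ

namespace MultiExit

open ZoneData Finset Classical

variable {V₁ E₁ U₁ U₂ : Type} (Z₁ : ZoneData V₁ E₁ U₁ U₂) [DecidableEq E₁] (st : E₁ → EStat) {f : E₁} {p q : V₁}
  (a b c : V₁)

/-- The anchored crossed classes are the same on the contracted host. -/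
theorem ancCrossedS_contract_iff (hf : st f = EStat.double) (hj : Z₁.Joins f p q) (ω : E₁ → Bool) :
    AncCrossedS Z₁ a b c st ω ↔
      AncCrossedS (contractHost Z₁ p q) (ren p q a) (ren p q b) (ren p q c) (stAbs st f) ω := by
  rw [ancCrossedS_iff, ancCrossedS_iff]
  simp only [RdS_contract_iff Z₁ st hf hj ω, MgS_contract_iff Z₁ st hf hj ω]

variable [Fintype E₁]

/-- **THEOREM (CONTRACTION OF A DOUBLE EDGE)** for the anchored orientation: the anchored conjecture on a status with
the double edge `f = p–q` follows from the anchored conjecture on the contracted host with `f` absent. -/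
theorem ancDominationS_of_contract (hf : st f = EStat.double) (hj : Z₁.Joins f p q)
    (h : AncDominationS (contractHost Z₁ p q) (ren p q a) (ren p q b) (ren p q c) (stAbs st f)) :
    AncDominationS Z₁ a b c st := by
  intro V hV
  exact (card_filter_congr' fun ω _ => and_congr_right fun _ =>
      ancCrossedS_contract_iff Z₁ st a b c hf hj ω).trans_le
    ((h V hV).trans_eq (card_filter_congr' fun ω _ => and_congr_right fun _ =>
      (topBotS_contract_iff Z₁ st a b c hf hj ω).symm))

/-- The converse: the anchored conjecture on the status gives it on the contracted host. -/
theorem ancDominationS_contract (hf : st f = EStat.double) (hj : Z₁.Joins f p q)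
    (h : AncDominationS Z₁ a b c st) :
    AncDominationS (contractHost Z₁ p q) (ren p q a) (ren p q b) (ren p q c) (stAbs st f) := by
  intro V hV
  exact (card_filter_congr' fun ω _ => and_congr_right fun _ =>
      (ancCrossedS_contract_iff Z₁ st a b c hf hj ω).symm).trans_le
    ((h V hV).trans_eq (card_filter_congr' fun ω _ => and_congr_right fun _ =>
      topBotS_contract_iff Z₁ st a b c hf hj ω))

/-- The two forms of the anchored conjecture are equivalent. -/
theorem ancDominationS_contract_iff (hf : st f = EStat.double) (hj : Z₁.Joins f p q) :
    AncDominationS Z₁ a b c st ↔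
      AncDominationS (contractHost Z₁ p q) (ren p q a) (ren p q b) (ren p q c) (stAbs st f) :=
  ⟨ancDominationS_contract Z₁ st a b c hf hj, ancDominationS_of_contract Z₁ st a b c hf hj⟩

end MultiExit

end ZoneZ

end PercRepro
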